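import Mathlib.RepresentationTheory.Homological.ContCohomology.Functoriality
import Mathlib.NumberTheory.Padics.PadicIntegers
import Literature.AnabelianGeometry.AbsoluteAnabelian.AbsTopIII.CuspidalCyclotome
import HarnessLib

/-!
# [AbsTopIII] Prop. 1.4 (ii), second half: the geometric cyclotome `M_X := Hom(H²(Δ_X, Ẑ), Ẑ)`

Mochizuki, *Topics in Absolute Anabelian Geometry III*, §1, Prop. 1.4 (ii), manuscript pp. 31–32
(lit key `paper:url-5493eb38cbb7`): "applying the differential of the '`E₂`-term' of the Leray
spectral sequence associated to this group extension [`1 → I_x → Δ^{c-cn}_{U_x} → Δ_X → 1`] to the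
element `1 ∈ Ẑ = Hom(I_x, I_x) = H⁰(Δ_X, H¹(I_x, I_x))` yields an element
`∈ H²(Δ_X, H⁰(I_x, I_x)) = Hom(M_X, I_x)`, where we write `M_X := Hom(H²(Δ_X, Ẑ), Ẑ)` [...]; this
last element corresponds to the natural isomorphism `M_X ⥲ I_x` [...]. In particular, this yields a
'purely group-theoretic algorithm' [...] for constructing this isomorphism from the surjection
`Δ_{U_x} ↠ Δ_X`."  This `M_X` is the cyclotome "`μ_Ẑ(Π_X)` as in Proposition 1.4, (ii)" of
Thm. 1.9 (b) and Cor. 1.10 (ii) (pp. 37, 42).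

The companion file `CuspidalCyclotome.lean` realised `M_X` EXTRINSICALLY, as the image `geomCyclotome q`
of `Ker(Δ_{U_x} ↠ Δ_X)` in the maximal cuspidally central quotient — which needs a cusp `x`.  Here the
INTRINSIC object is made REAL over an abstract extension `E` (`Δ = E.geom`), with Mathlib's
continuous cohomology (`continuousCohomology`, homogeneous continuous cochains):

* `geomTrivialRep E Λ` — the `Δ`-module `Λ` with trivial action; `geomH2 E Λ := H²(Δ, Λ)`;
  `geomCyclotomeDual E Λ := Hom(H²(Δ, Λ), Λ)` = "`M_X`" with coefficients `Λ` (any topological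
  abelian group, as a topological `ℤ`-module; the text's `Λ = Ẑ` is `ZHatCoeff`, Mathlib's `∏_p ℤ_p`
  lifted to the ambient universe);
* the `Π`-action: `geomConj E g : Δ →ₜ* Δ` (conjugation by `g ∈ Π`), `geomH2Map E Λ g : H²(Δ, Λ) → H²(Δ, Λ)`
  (functoriality of continuous cohomology) and `geomCyclotomeDualMap E Λ g : M_X → M_X` (precomposition);
  the action axioms (`g = 1`, `g h`) are NOT proved here (they follow from `ContinuousCohomology.map_id`
  / `map_comp`; recorded as discharge debt) — the maps themselves are the data consumers need;
* the NAMED FACT `CurveModel.Prop_1_4_ii_sync M` (relative to a model `M`): for a cyclotome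
  presentation `(U_x ⊆ X, x)` there is an identification `M_X ≅ I_x` (the latter in its realisation
  `geomCyclotome (M.res h)`) compatible with the `Π_{U_x}`-actions.  Only EXISTENCE of an equivariant
  identification is asserted; the specific isomorphism given by the Leray differential is not
  constructed (no Lyndon–Hochschild–Serre spectral sequence for continuous cohomology in Mathlib).
-/

noncomputable section

open CategoryTheory

universe u

namespace Literature.AnabelianGeometry.AbsoluteAnabelian.AbsTopIII

/-! ### Coefficients -/

/-- `Ẑ ≅ ∏_p ℤ_p` (Chinese remainder theorem) as a topological commutative ring in universe `u`:
Mathlib's `p`-adic integers over all primes, universe-lifted — the coefficient ring of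
"`M_X := Hom(H²(Δ_X, Ẑ), Ẑ)`" (Prop. 1.4 (ii) p. 31).  (The tree's `SemiGraphs.ZHat`, the profinite
completion of the group `ℤ`, is a bare profinite group and cannot serve as a coefficient module.)
[cite: MochizukiAbsTopIII2015, Prop 1.4 (ii) p.31] -/
abbrev ZHatCoeff : Type u := ULift.{u} (∀ p : Nat.Primes, @PadicInt (p : ℕ) ⟨p.2⟩)

/-! ### `H²(Δ_X, Λ)` and `M_X(Λ) = Hom(H²(Δ_X, Λ), Λ)` -/

section Cyclotome

variable (E : FundamentalExtension.{u}) (Λ : Type u) [AddCommGroup Λ] [TopologicalSpace Λ]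
  [IsTopologicalAddGroup Λ]

/-- The `Δ_X`-module `Λ` with TRIVIAL action (`H²(Δ_X, Ẑ)` on p. 31 has constant coefficients), as an
object of Mathlib's category of topological representations. [cite: MochizukiAbsTopIII2015, Prop 1.4 (ii) p.31] -/
abbrev geomTrivialRep : TopRep.{u} ℤ E.geom := TopRep.of (ContRepresentation.trivial ℤ E.geom Λ)

/-- **`H²(Δ_X, Λ)`**: Mathlib's continuous cohomology in degree `2` of the trivial `Δ_X`-module `Λ`
(a topological `ℤ`-module). [cite: MochizukiAbsTopIII2015, Prop 1.4 (ii) p.31] -/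
abbrev geomH2 : TopModuleCat.{u} ℤ := continuousCohomology.{0, u, u} 2 (geomTrivialRep E Λ)

/-- **`M_X(Λ) := Hom(H²(Δ_X, Λ), Λ)`** (`ℤ`-linear maps; for `Λ = Ẑ`, where every additive map
`Ẑ → Ẑ` is continuous and `Ẑ`-linear, this is "`M_X := Hom(H²(Δ_X, Ẑ), Ẑ)`" of Prop. 1.4 (ii) p. 31,
i.e. "`μ_Ẑ(Π_X)` as in Proposition 1.4, (ii)" of Thm. 1.9 (b) / Cor. 1.10 (ii); no continuity is
imposed, so the definition does not depend on the topology carried by Mathlib's `H²`).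
[cite: MochizukiAbsTopIII2015, Prop 1.4 (ii) p.31] -/
abbrev geomCyclotomeDual : Type u := (geomH2 E Λ) →ₗ[ℤ] Λ

/-! ### The `Π_X`-action by conjugation on `Δ_X` -/

/-- Conjugation by `g ∈ Π` on the normal subgroup `Δ`, as a continuous homomorphism `Δ → Δ`.
[cite: MochizukiAbsTopIII2015, Prop 1.4 (ii) p.31] -/
def geomConj (g : E.arith) : E.geom →ₜ* E.geom where
  toFun x := ⟨g * x * g⁻¹, E.normal_geom.conj_mem _ x.2 g⟩
  map_one' := Subtype.ext (by simp)
  map_mul' x y := Subtype.ext (by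
    simp only [Subgroup.coe_mul]
    group)
  continuous_toFun :=
    ((continuous_const.mul continuous_subtype_val).mul continuous_const).subtype_mk _

/-- `geomConj g x = g x g⁻¹`. [cite: MochizukiAbsTopIII2015, Prop 1.4 (ii) p.31] -/
@[simp] theorem coe_geomConj_apply (g : E.arith) (x : E.geom) :
    (geomConj E g x : E.arith) = g * x * g⁻¹ :=
  rfl

/-- The identity of `Λ` as a morphism from the restriction of the trivial `Δ`-module along
`geomConj g` to the trivial `Δ`-module (both actions are trivial).
[cite: MochizukiAbsTopIII2015, Prop 1.4 (ii) p.31] -/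
def geomTrivialResHom (g : E.arith) :
    TopRep.res (geomConj E g : E.geom →* E.geom) (geomTrivialRep E Λ) ⟶ geomTrivialRep E Λ :=
  TopRep.ofHom
    { toContinuousLinearMap := ContinuousLinearMap.id ℤ Λ
      isIntertwining' := fun _ => by
        ext v
        rfl }

/-- **`H²(c_g) : H²(Δ_X, Λ) → H²(Δ_X, Λ)`**, the map induced on continuous cohomology by conjugation
by `g ∈ Π_X` (functoriality of `H²` in the group; through it `Π_X` — and, since inner automorphisms of
`Δ_X` act trivially on cohomology, `G_k` — acts on `H²(Δ_X, Ẑ)`).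
[cite: MochizukiAbsTopIII2015, Prop 1.4 (ii) p.31] -/
def geomH2Map (g : E.arith) : geomH2 E Λ ⟶ geomH2 E Λ :=
  ContinuousCohomology.map (geomConj E g) (geomTrivialResHom E Λ g) 2

/-- **The action of `g ∈ Π_X` on `M_X(Λ)`**: precomposition with `H²(c_g)`,
`m ↦ m ∘ H²(c_g)` (so that `(gh)·m = g·(h·m)`).  The action axioms are not proved in this file.
[cite: MochizukiAbsTopIII2015, Prop 1.4 (ii) p.31] -/
def geomCyclotomeDualMap (g : E.arith) : geomCyclotomeDual E Λ →ₗ[ℤ] geomCyclotomeDual E Λ where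
  toFun m := m.comp (geomH2Map E Λ g).hom.toLinearMap
  map_add' m m' := by
    ext ξ
    rfl
  map_smul' c m := by
    ext ξ
    rfl

/-- Formula for the action. [cite: MochizukiAbsTopIII2015, Prop 1.4 (ii) p.31] -/
@[simp] theorem geomCyclotomeDualMap_apply (g : E.arith) (m : geomCyclotomeDual E Λ)
    (ξ : geomH2 E Λ) : geomCyclotomeDualMap E Λ g m ξ = m ((geomH2Map E Λ g).hom ξ) :=
  rfl

end Cyclotome

/-! ### `μ_Ẑ(Π_U)` for an open `U ⊆ X` (Rmk. 1.10.1 (ii)) and the synchronization fact -/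

namespace CurveModel

variable (M : CurveModel.{u})

/-- For a cofinite open `U ⊆ X` of the model, "`μ_Ẑ(Π_U)`" is `M_X` of the compactification `X`
with `Π_U` acting through `Π_U ↠ Π_X` (Thm. 1.9 (b) p. 37 "`μ_Ẑ(Π_U) := M_Z`", `Z` the canonical
compactification; Rmk. 1.10.1 (ii) p. 44): the action map of `g ∈ Π_U` on `M_X(Λ)`.
[cite: MochizukiAbsTopIII2015, Thm 1.9 (b) p.37] -/
abbrev cyclotomeActionOfOpen {U X : M.Curve} (h : M.IsCofiniteOpen U X) (Λ : Type u)
    [AddCommGroup Λ] [TopologicalSpace Λ] [IsTopologicalAddGroup Λ] (g : (M.ext U).arith) :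
    geomCyclotomeDual (M.ext X) Λ →ₗ[ℤ] geomCyclotomeDual (M.ext X) Λ :=
  geomCyclotomeDualMap (M.ext X) Λ ((M.res h).arith g)

/-- **Prop. 1.4 (ii), second half, relative to `M`** ("this last element corresponds to the natural
isomorphism `M_X ⥲ I_x`", p. 31–32): for every cyclotome presentation `(U_x ⊆ X, x)` of the model
(`IsCyclotomePresentation`: `X` proper, `x` rational with `I_x ≅ Ẑ`, `U_x = X ∖ {x}`, the sequence
`1 → I_x → Δ^{c-cn}_{U_x} → Δ_X → 1` exact) there is an isomorphism of abelian groups between the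
INTRINSIC cyclotome `M_X = Hom(H²(Δ_X, Ẑ), Ẑ)` and the copy `geomCyclotome (M.res h)` of `I_x`
inside `Δ^{c-cn}_{U_x}`, compatible with the actions of `Π_{U_x}` (on `M_X` through `Π_{U_x} ↠ Π_X`
and `H²(c_g)`; on `geomCyclotome` by conjugation in `Π_{U_x}/[N, Δ]⁻`).  Only the EXISTENCE of an
equivariant identification is typed (the Leray-differential isomorphism itself is not constructed).
NAMED FACT relative to `M`. [cite: MochizukiAbsTopIII2015, Prop 1.4 (ii) p.31] -/
def Prop_1_4_ii_sync (M : CurveModel.{u}) : Prop :=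
  ∀ (Ux X : M.Curve) (h : M.IsCofiniteOpen Ux X) (x : (M.cusps Ux).Cusp),
    M.IsCyclotomePresentation h x →
      ∃ φ : geomCyclotomeDual (M.ext X) ZHatCoeff.{u} ≃+ Additive (geomCyclotome (M.res h)),
        ∀ (g : (M.ext Ux).arith) (m : geomCyclotomeDual (M.ext X) ZHatCoeff.{u}),
          Additive.toMul (φ (M.cyclotomeActionOfOpen h ZHatCoeff.{u} g m)) =
            MulAut.conjNormal (QuotientGroup.mk g : CuspidallyCentralQuotient (M.res h))
              (Additive.toMul (φ m))

end CurveModel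

end Literature.AnabelianGeometry.AbsoluteAnabelian.AbsTopIII
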